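import Mathlib

/-!
# Beta / TentQuasiReconstruction1D — the 1-D TRAPEZOID (tent) profile of a block quasi-reconstruction on the discrete
# circle ℤ/m × Fin n (m blocks of n sites): block sums (own block n, each neighbour ≤ w, others 0), at most three tents
# at a site, and (1/w)-Lipschitz along the cyclic successor — the 1-D data that `TentQuasiReconstructionTorus` tensors into
# the ν-dimensional instance of E-I3 at U = 1 (unit `b2b-balaban-beta-d4-p2`, GEN 5, MODEL crew; the row-D4 owner's OFFER
# journal l.14232 ∕ NOTE-I3 §3 (b2): «a TRAPEZOID∕tent quasi-reconstruction r_y (≡ 1 on block y, linear ramps of width w ≤ n/2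
# into the neighbours)»)

HONEST FRAMING: discharging `BetaPertH` makes Bałaban's UV stability UNCONDITIONAL — NOT the continuum limit, NOT the
Clay problem.  HONEST DEPENDENCY (verbatim): «continuum YM on T⁴ ⇐ BetaPertH ∧ nine spine estimates (0/9 proved);
BetaPertH ⇐ (D1) ∧ (D4) ∧ CAP+tail; G-an2-4 gates asym, D1 and NE2/3/4.»  THIS MODULE DISCHARGES NOTHING of `BetaPertH`,
asserts NOTHING printed and cites nothing as a fact (ABSOLUTE RULE): [folklore] arithmetic of an explicit piecewise-linear
profile (MODEL; no operator of Bałaban's; the shape located at [B6] = `Balaban1984PropagatorsII` (2.72)–(2.78) p. 236 is the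
COERCIVITY it will feed, proved abstractly by an4's `CoarseCoerciveQuasiReconstruction`).

CONTENT ([folklore]; `m ≥ 3` blocks so that a block and its two neighbours are distinct; `1 ≤ w ≤ n` for the edge bounds).
* §1 `ramp w k = max 0 (1 − k/w)`: values in [0,1], `ramp w k = 0` for `w ≤ k`, (1/w)-Lipschitz in k, `Σ_{j<n} ramp w (j+1) ≤ w`.
* §2 the profile `prof w δ j` (δ = block offset ∈ ℤ/m: 1 on δ = 0, right ramp on δ = 1, left ramp on δ = −1, else 0) and
  the tent `tent w y (b, j) = prof w (b − y) j`; `blockSum` (= n at δ = 0, ≤ w at δ = ±1, 0 otherwise);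
  `sum_tent_mul_ind` (M₁(y, b) = blockSum (b − y)), **`sum_ind_self`**, **`rowSum_offdiag_le`**, **`colSum_offdiag_le`**
  (≤ 2w), `sum_tent_le` (≤ n + 2w), `sum_tents_at_le` (≤ 3 at every site).
* (§3 — the cyclic successor and the edge differences — is the sibling `TentQuasiReconstruction1DEdges`.)
Row D4: RECORDS value (first half of E-I3 at U = 1 in MODEL currency); class of (I3)/G-B9-15 unchanged; D4 DISCHARGE NO DATE;
NOT BetaPertH, NOT continuum, NOT Clay.
-/

namespace Summit.QuantumFields.BalabanUV.Beta.TentQuasiReconstruction1D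

open Finset

noncomputable section

/-! ## §1  The ramp -/

/-- The ramp profile `max 0 (1 − k/w)`. [folklore] -/
def ramp (w k : ℕ) : ℝ := max 0 (1 - (k : ℝ) / w)

/-- `0 ≤ ramp`. [folklore] -/
theorem ramp_nonneg (w k : ℕ) : 0 ≤ ramp w k := le_max_left _ _

/-- `ramp ≤ 1`. [folklore] -/
theorem ramp_le_one (w k : ℕ) : ramp w k ≤ 1 := by
  refine max_le zero_le_one ?_
  have : (0 : ℝ) ≤ (k : ℝ) / w := by positivity
  linarith

/-- `ramp w k = 0` once `w ≤ k` (`w ≥ 1`). [folklore] -/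
theorem ramp_eq_zero {w k : ℕ} (hw : 1 ≤ w) (hk : w ≤ k) : ramp w k = 0 := by
  unfold ramp
  have hw' : (0 : ℝ) < w := by exact_mod_cast hw
  have : (1 : ℝ) ≤ (k : ℝ) / w := by rw [le_div_iff₀ hw']; exact_mod_cast (by simpa using hk)
  exact max_eq_left (by linarith)

/-- `ramp w 0 = 1`. [folklore] -/
theorem ramp_zero (w : ℕ) : ramp w 0 = 1 := by simp [ramp]

/-- The ramp is (1/w)-Lipschitz: `|ramp w (k+1) − ramp w k| ≤ 1/w`. [folklore] -/
theorem abs_ramp_succ_sub_le {w : ℕ} (hw : 1 ≤ w) (k : ℕ) : |ramp w (k + 1) - ramp w k| ≤ 1 / w := by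
  unfold ramp
  have hw' : (0 : ℝ) < w := by exact_mod_cast hw
  have h1 : (1 : ℝ) - ((k + 1 : ℕ) : ℝ) / w = (1 - (k : ℝ) / w) - 1 / w := by push_cast; ring
  rw [h1]
  calc |max 0 (1 - (k : ℝ) / w - 1 / w) - max 0 (1 - (k : ℝ) / w)|
      ≤ max |(0 : ℝ) - 0| |(1 - (k : ℝ) / w - 1 / w) - (1 - (k : ℝ) / w)| := abs_max_sub_max_le_max _ _ _ _
    _ = 1 / w := by
        rw [sub_self, abs_zero, show (1 - (k : ℝ) / w - 1 / w) - (1 - (k : ℝ) / w) = -(1 / w) by ring, abs_neg,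
          abs_of_pos (by positivity), max_eq_right (by positivity)]

/-- `ramp w (k+1) ≤ [k < w]`. [folklore] -/
theorem ramp_succ_le_ite {w : ℕ} (hw : 1 ≤ w) (k : ℕ) : ramp w (k + 1) ≤ if k < w then 1 else 0 := by
  split_ifs with h
  · exact ramp_le_one _ _
  · rw [ramp_eq_zero hw (by omega)]

/-- **The ramp has mass ≤ w on a block**: `Σ_{j : Fin n} ramp w (j+1) ≤ w`. [folklore] -/
theorem sum_ramp_succ_le {w : ℕ} (hw : 1 ≤ w) (n : ℕ) : ∑ j : Fin n, ramp w (j.val + 1) ≤ w := by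
  calc ∑ j : Fin n, ramp w (j.val + 1) ≤ ∑ j : Fin n, (if j.val < w then (1 : ℝ) else 0) :=
        Finset.sum_le_sum fun j _ => ramp_succ_le_ite hw j.val
    _ = ((univ.filter fun j : Fin n => j.val < w).card : ℝ) := by rw [Finset.sum_boole]
    _ ≤ w := by
        have h : (univ.filter fun j : Fin n => j.val < w).card ≤ w := by
          calc (univ.filter fun j : Fin n => j.val < w).card
              ≤ (Finset.range w).card := Finset.card_le_card_of_injOn (fun j => j.val)
                  (fun j hj => by simpa using (Finset.mem_filter.mp hj).2) (fun a _ b _ h => Fin.ext h)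
            _ = w := Finset.card_range w
        exact_mod_cast h

/-- The reflected ramp sum is the same sum: `Σ_j ramp w (n − j) = Σ_j ramp w (j+1)`. [folklore] -/
theorem sum_ramp_rev (w n : ℕ) : ∑ j : Fin n, ramp w (n - j.val) = ∑ j : Fin n, ramp w (j.val + 1) := by
  refine Fintype.sum_equiv Fin.revPerm _ _ fun j => ?_
  rw [Fin.revPerm_apply, Fin.val_rev]
  congr 1
  omega

/-! ## §2  The profile, the tent, block sums -/

variable {m : ℕ} {n : ℕ}

/-- The profile by block offset: own block 1, right neighbour the right ramp, left neighbour the left ramp, else 0.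
[folklore] -/
def prof (n w : ℕ) (δ : ZMod m) (j : Fin n) : ℝ :=
  if δ = 0 then 1 else if δ = 1 then ramp w (j.val + 1) else if δ = -1 then ramp w (n - j.val) else 0

/-- **The 1-D tent of block y**: `tent w y (b, j) = prof (b − y) j`. [folklore] -/
def tent (n w : ℕ) (y : ZMod m) (x : ZMod m × Fin n) : ℝ := prof n w (x.1 - y) x.2

/-- The block indicator. [folklore] -/
def ind (n : ℕ) (b : ZMod m) (x : ZMod m × Fin n) : ℝ := if x.1 = b then 1 else 0

/-- In ℤ/m with m ≥ 3: 1 ≠ 0. [folklore] -/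
theorem one_ne_zero_zmod (hm : 3 ≤ m) : (1 : ZMod m) ≠ 0 := by
  intro h
  have := (ZMod.natCast_eq_zero_iff 1 m).1 (by simpa using h)
  have := Nat.le_of_dvd one_pos this
  omega

/-- In ℤ/m with m ≥ 3: −1 ≠ 0. [folklore] -/
theorem neg_one_ne_zero_zmod (hm : 3 ≤ m) : (-1 : ZMod m) ≠ 0 :=
  fun h => one_ne_zero_zmod hm (neg_eq_zero.mp h)

/-- In ℤ/m with m ≥ 3: 1 ≠ −1. [folklore] -/
theorem one_ne_neg_one_zmod (hm : 3 ≤ m) : (1 : ZMod m) ≠ -1 := by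
  intro h
  have h2 : (2 : ZMod m) = 0 := by
    calc (2 : ZMod m) = 1 + 1 := by norm_num
      _ = 1 + -1 := by rw [← h]
      _ = 0 := by ring
  have := (ZMod.natCast_eq_zero_iff 2 m).1 (by simpa using h2)
  have := Nat.le_of_dvd two_pos this
  omega

/-- `0 ≤ prof ≤ 1`. [folklore] -/
theorem prof_mem (w : ℕ) (δ : ZMod m) (j : Fin n) : 0 ≤ prof n w δ j ∧ prof n w δ j ≤ 1 := by
  unfold prof
  split_ifs
  · exact ⟨zero_le_one, le_rfl⟩
  · exact ⟨ramp_nonneg _ _, ramp_le_one _ _⟩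
  · exact ⟨ramp_nonneg _ _, ramp_le_one _ _⟩
  · exact ⟨le_rfl, zero_le_one⟩

/-- `0 ≤ tent`. [folklore] -/
theorem tent_nonneg (w : ℕ) (y : ZMod m) (x : ZMod m × Fin n) : 0 ≤ tent n w y x := (prof_mem w _ _).1

/-- `tent ≤ 1`. [folklore] -/
theorem tent_le_one (w : ℕ) (y : ZMod m) (x : ZMod m × Fin n) : tent n w y x ≤ 1 := (prof_mem w _ _).2

/-- The profile is dominated by the indicator of the three nearby offsets. [folklore] -/
theorem prof_le_ind3 (w : ℕ) (δ : ZMod m) (j : Fin n) :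
    prof n w δ j ≤ (if δ = 0 then (1 : ℝ) else 0) + (if δ = 1 then (1 : ℝ) else 0) + (if δ = -1 then (1 : ℝ) else 0) := by
  unfold prof
  split_ifs <;> first
    | linarith [ramp_nonneg w (j.val + 1), ramp_le_one w (j.val + 1), ramp_nonneg w (n - j.val), ramp_le_one w (n - j.val)]

/-- **At most three tents see a site**: `Σ_y tent y x ≤ 3`. [folklore] -/
theorem sum_tents_at_le [NeZero m] (w : ℕ) (x : ZMod m × Fin n) : ∑ y : ZMod m, tent n w y x ≤ 3 := by
  have h := fun y : ZMod m => prof_le_ind3 (n := n) w (x.1 - y) x.2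
  calc ∑ y : ZMod m, tent n w y x
      ≤ ∑ y : ZMod m, ((if x.1 - y = 0 then (1 : ℝ) else 0) + (if x.1 - y = 1 then (1 : ℝ) else 0) +
          (if x.1 - y = -1 then (1 : ℝ) else 0)) := Finset.sum_le_sum fun y _ => h y
    _ = 3 := by
        simp only [sub_eq_iff_eq_add, zero_add, Finset.sum_add_distrib]
        have e1 : ∑ y : ZMod m, (if x.1 = y then (1 : ℝ) else 0) = 1 := by rw [Finset.sum_ite_eq]; simp
        have e2 : ∑ y : ZMod m, (if x.1 = 1 + y then (1 : ℝ) else 0) = 1 := by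
          have : ∀ y : ZMod m, (x.1 = 1 + y) ↔ (x.1 - 1 = y) := fun y => by constructor <;> intro h <;> linear_combination h
          simp only [this]; rw [Finset.sum_ite_eq]; simp
        have e3 : ∑ y : ZMod m, (if x.1 = -1 + y then (1 : ℝ) else 0) = 1 := by
          have : ∀ y : ZMod m, (x.1 = -1 + y) ↔ (x.1 + 1 = y) := fun y => by constructor <;> intro h <;> linear_combination h
          simp only [this]; rw [Finset.sum_ite_eq]; simp
        rw [e1, e2, e3]; norm_num

/-- MODEL bookkeeping: the block sum of the profile at offset δ. [folklore] -/
def blockSum (n w : ℕ) (δ : ZMod m) : ℝ := ∑ j : Fin n, prof n w δ j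

/-- Own block: `blockSum 0 = n`. [folklore] -/
theorem blockSum_zero (w : ℕ) : blockSum (m := m) n w 0 = n := by
  simp [blockSum, prof]

/-- `blockSum ≥ 0`. [folklore] -/
theorem blockSum_nonneg (w : ℕ) (δ : ZMod m) : 0 ≤ blockSum (m := m) n w δ :=
  Finset.sum_nonneg fun j _ => (prof_mem w δ j).1

/-- **Off the own block the block sum is ≤ w·([δ = 1] + [δ = −1])** (`m ≥ 3`, `w ≥ 1`). [folklore] -/
theorem blockSum_le_of_ne_zero (hm : 3 ≤ m) {w : ℕ} (hw : 1 ≤ w) {δ : ZMod m} (hδ : δ ≠ 0) :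
    blockSum (m := m) n w δ ≤ (w : ℝ) * ((if δ = 1 then (1 : ℝ) else 0) + (if δ = -1 then (1 : ℝ) else 0)) := by
  unfold blockSum prof
  simp only [hδ, if_false]
  by_cases h1 : δ = 1
  · simp only [h1, if_true, one_ne_neg_one_zmod hm, if_false, add_zero, mul_one]
    exact sum_ramp_succ_le hw n
  · simp only [h1, if_false, zero_add]
    by_cases h2 : δ = -1
    · simp only [h2, if_true, mul_one]
      rw [sum_ramp_rev]; exact sum_ramp_succ_le hw n
    · simp only [h2, if_false, Finset.sum_const_zero, mul_zero, le_refl]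

/-- **The block sum at every offset**: `blockSum δ ≤ n·[δ = 0] + w·([δ = 1] + [δ = −1])`. [folklore] -/
theorem blockSum_le (hm : 3 ≤ m) {w : ℕ} (hw : 1 ≤ w) (δ : ZMod m) :
    blockSum (m := m) n w δ ≤ (n : ℝ) * (if δ = 0 then (1 : ℝ) else 0) +
      (w : ℝ) * ((if δ = 1 then (1 : ℝ) else 0) + (if δ = -1 then (1 : ℝ) else 0)) := by
  by_cases hδ : δ = 0
  · subst hδ
    rw [blockSum_zero]
    simp only [if_true, mul_one, (one_ne_zero_zmod hm).symm, (neg_one_ne_zero_zmod hm).symm, if_false, add_zero,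
      mul_zero, le_refl]
  · rw [if_neg hδ, mul_zero, zero_add]
    exact blockSum_le_of_ne_zero hm hw hδ

/-- **Block sums of a tent**: `Σ_x tent y x · ind b x = blockSum (b − y)`. [folklore] -/
theorem sum_tent_mul_ind [NeZero m] (w : ℕ) (y b : ZMod m) :
    ∑ x : ZMod m × Fin n, tent n w y x * ind n b x = blockSum (m := m) n w (b - y) := by
  rw [Fintype.sum_prod_type]
  simp only [tent, ind, mul_ite, mul_one, mul_zero]
  rw [show (∑ a : ZMod m, ∑ j : Fin n, if a = b then prof n w (a - y) j else 0) =
      ∑ a : ZMod m, (if a = b then ∑ j : Fin n, prof n w (a - y) j else 0) from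
    Finset.sum_congr rfl fun a _ => by split_ifs <;> simp, Finset.sum_ite_eq']
  simp [blockSum]

/-- **Own block sum = n.** [folklore] -/
theorem sum_ind_self [NeZero m] (w : ℕ) (y : ZMod m) : ∑ x : ZMod m × Fin n, tent n w y x * ind n y x = n := by
  rw [sum_tent_mul_ind, sub_self, blockSum_zero]

/-- Block sums are ≥ 0. [folklore] -/
theorem sum_tent_mul_ind_nonneg [NeZero m] (w : ℕ) (y b : ZMod m) : 0 ≤ ∑ x : ZMod m × Fin n, tent n w y x * ind n b x := by
  rw [sum_tent_mul_ind]; exact blockSum_nonneg _ _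

/-- **Off-diagonal ROW sums of the block sums are ≤ 2w**: `Σ_{b ≠ y} Σ_x tent y x·ind b x ≤ 2w`. [folklore] -/
theorem rowSum_offdiag_le [NeZero m] (hm : 3 ≤ m) {w : ℕ} (hw : 1 ≤ w) (y : ZMod m) :
    ∑ b ∈ univ.erase y, ∑ x : ZMod m × Fin n, tent n w y x * ind n b x ≤ 2 * w := by
  have hpt : ∀ b ∈ univ.erase y, ∑ x : ZMod m × Fin n, tent n w y x * ind n b x ≤
      (w : ℝ) * ((if b - y = 1 then (1 : ℝ) else 0) + (if b - y = -1 then (1 : ℝ) else 0)) := by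
    intro b hb
    rw [sum_tent_mul_ind]
    exact blockSum_le_of_ne_zero hm hw (sub_ne_zero.mpr (Finset.ne_of_mem_erase hb))
  refine (Finset.sum_le_sum hpt).trans ?_
  refine (Finset.sum_le_univ_sum_of_nonneg fun b => by positivity).trans ?_
  rw [← Finset.mul_sum, Finset.sum_add_distrib]
  have e1 : ∑ b : ZMod m, (if b - y = 1 then (1 : ℝ) else 0) = 1 := by
    have : ∀ b : ZMod m, (b - y = 1) ↔ (y + 1 = b) := fun b => by constructor <;> intro h <;> linear_combination -h
    simp only [this]; rw [Finset.sum_ite_eq]; simp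
  have e2 : ∑ b : ZMod m, (if b - y = -1 then (1 : ℝ) else 0) = 1 := by
    have : ∀ b : ZMod m, (b - y = -1) ↔ (y - 1 = b) := fun b => by constructor <;> intro h <;> linear_combination -h
    simp only [this]; rw [Finset.sum_ite_eq]; simp
  rw [e1, e2]; linarith

/-- **Off-diagonal COLUMN sums of the block sums are ≤ 2w**: `Σ_{y ≠ b} Σ_x tent y x·ind b x ≤ 2w`. [folklore] -/
theorem colSum_offdiag_le [NeZero m] (hm : 3 ≤ m) {w : ℕ} (hw : 1 ≤ w) (b : ZMod m) :
    ∑ y ∈ univ.erase b, ∑ x : ZMod m × Fin n, tent n w y x * ind n b x ≤ 2 * w := by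
  have hpt : ∀ y ∈ univ.erase b, ∑ x : ZMod m × Fin n, tent n w y x * ind n b x ≤
      (w : ℝ) * ((if b - y = 1 then (1 : ℝ) else 0) + (if b - y = -1 then (1 : ℝ) else 0)) := by
    intro y hy
    rw [sum_tent_mul_ind]
    exact blockSum_le_of_ne_zero hm hw (sub_ne_zero.mpr (Finset.ne_of_mem_erase hy).symm)
  refine (Finset.sum_le_sum hpt).trans ?_
  refine (Finset.sum_le_univ_sum_of_nonneg fun y => by positivity).trans ?_
  rw [← Finset.mul_sum, Finset.sum_add_distrib]
  have e1 : ∑ y : ZMod m, (if b - y = 1 then (1 : ℝ) else 0) = 1 := by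
    have : ∀ y : ZMod m, (b - y = 1) ↔ (b - 1 = y) := fun y => by constructor <;> intro h <;> linear_combination h
    simp only [this]; rw [Finset.sum_ite_eq]; simp
  have e2 : ∑ y : ZMod m, (if b - y = -1 then (1 : ℝ) else 0) = 1 := by
    have : ∀ y : ZMod m, (b - y = -1) ↔ (b + 1 = y) := fun y => by constructor <;> intro h <;> linear_combination h
    simp only [this]; rw [Finset.sum_ite_eq]; simp
  rw [e1, e2]; linarith

/-- **The total mass of a tent is ≤ n + 2w.** [folklore] -/
theorem sum_tent_le [NeZero m] (hm : 3 ≤ m) {w : ℕ} (hw : 1 ≤ w) (y : ZMod m) :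
    ∑ x : ZMod m × Fin n, tent n w y x ≤ n + 2 * w := by
  have hdecomp : ∑ x : ZMod m × Fin n, tent n w y x = ∑ b : ZMod m, blockSum (m := m) n w (b - y) := by
    rw [Fintype.sum_prod_type]
    exact Finset.sum_congr rfl fun b _ => rfl
  rw [hdecomp]
  calc ∑ b : ZMod m, blockSum (m := m) n w (b - y)
      ≤ ∑ b : ZMod m, ((n : ℝ) * (if b - y = 0 then (1 : ℝ) else 0) +
          (w : ℝ) * ((if b - y = 1 then (1 : ℝ) else 0) + (if b - y = -1 then (1 : ℝ) else 0))) :=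
        Finset.sum_le_sum fun b _ => blockSum_le hm hw _
    _ = n + 2 * w := by
        rw [Finset.sum_add_distrib, ← Finset.mul_sum, ← Finset.mul_sum, Finset.sum_add_distrib]
        have e0 : ∑ b : ZMod m, (if b - y = 0 then (1 : ℝ) else 0) = 1 := by
          have : ∀ b : ZMod m, (b - y = 0) ↔ (y = b) := fun b => by constructor <;> intro h <;> linear_combination -h
          simp only [this]; rw [Finset.sum_ite_eq]; simp
        have e1 : ∑ b : ZMod m, (if b - y = 1 then (1 : ℝ) else 0) = 1 := by
          have : ∀ b : ZMod m, (b - y = 1) ↔ (y + 1 = b) := fun b => by constructor <;> intro h <;> linear_combination -h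
          simp only [this]; rw [Finset.sum_ite_eq]; simp
        have e2 : ∑ b : ZMod m, (if b - y = -1 then (1 : ℝ) else 0) = 1 := by
          have : ∀ b : ZMod m, (b - y = -1) ↔ (y - 1 = b) := fun b => by constructor <;> intro h <;> linear_combination -h
          simp only [this]; rw [Finset.sum_ite_eq]; simp
        rw [e0, e1, e2]; ring

end

end Summit.QuantumFields.BalabanUV.Beta.TentQuasiReconstruction1D
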